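import Mathlib.Analysis.Calculus.MeanValue
import Mathlib.Analysis.Convex.Deriv
import Mathlib.Analysis.SpecialFunctions.Integrals.Basic
import Mathlib.MeasureTheory.Integral.IntervalIntegral.FundThmCalculus
import Mathlib.MeasureTheory.Integral.DominatedConvergence
import Literature.Probability.LatticeModels.SharpnessSubcritical
import Literature.Probability.LatticeModels.ModifiedSimonInequality
import Literature.Probability.LatticeModels.IsingMonotonicity
import Literature.Probability.LatticeModels.GKSInequalities
import HarnessLib

/-!
# The mean-field lower bound `⟨σ₀⟩⁺_β ≥ √(1 - β̃_c²/β²)` (Duminil-Copin–Tassion 2016, eq. (2.6)):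
# decomposition into named facts

Topic `Probability/LatticeModels`, namespace `Literature.CritIsing`. This file serves the discharge of
the named fact `dct_magnetization_lower_bound` of `SharpnessSubcritical` — after
`dct_modifiedSimon_finiteVolume_holds` the only remaining input of crit-ising.S08
(`twoPoint_exponentialDecay_of_dct_magnetization_lower_bound`). It vendors the printed
intermediate results of Duminil-Copin–Tassion, CMP 343 (2016) 725, §2.4 (numbering of
arXiv:1502.03050, the held version) with the correction CMP 359 (2018) 821, and the two classical
inputs they invoke, as named facts, and **proves** the real analysis assembling them
(integration of the differential inequality (2.8) between `β₁` and `β`, the limit `Λ_n ↑ ℤ^d`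
through (2.10), and `h ↘ 0`): `dct_magnetization_lower_bound_of_facts`, and hence
crit-ising.S08 from these four facts alone (`twoPoint_exponentialDecay_of_meanField_facts`).

## Parametrisation of the magnetic field

Duminil-Copin–Tassion (and Friedli–Velenik 2017, eq. (3.1)) weight configurations by
`exp(β ∑_{xy} σ_xσ_y + h ∑_x σ_x)`, whereas the tree's finite-volume Gibbs measure
`isingMeasure G Λ β h bc` uses `exp(-β H_{Λ;h})` with `H_{Λ;h} = -∑ σ_xσ_y - h ∑ σ_x`, i.e. the
field enters as `βh`. Accordingly DCT's state `⟨·⟩_{Λ,β,h}` is the tree's free state at field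
`h/β` (`dctCorr`, for `β > 0`), and DCT's derivative `d/dβ` at fixed `h` is the derivative of
`β ↦ dctCorr Λ β h`.

## Contents (all for the nearest-neighbour model on `ℤ^d`, free boundary condition)

* `dctCorr`, `dctMag` — `⟨σ_A⟩_{Λ,β,h}`, `⟨σ₀⟩_{Λ,β,h}` in DCT's parametrisation;
* `dctRatioConst Λ β h = c(Λ) := min_{y ∈ Λ} ⟨σ₀⟩_{Λ,β,h} / ⟨σ_y⟩_{Λ,β,h}` (§2.4);
* `dctBoundaryError Λ β h = ε(Λ,β,h) := 2 ∑_{x ∈ Λ} ∑_{y ∉ Λ, y ∼ x} (⟨σ₀σ_x⟩ - ⟨σ₀⟩⟨σ_x⟩)_{Λ,β,h}`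
  (the correcting term of CMP 359 (2018) 821, with `J_{xy} = 1_{x ∼ y}`);
* named facts: `dct_meanField_differentialInequality` (Lemma 2.6 as corrected in 2018),
  `dct_boundaryError_tendsto_zero` (ibid.: "the GHS inequality classically implies that
  `ε(Λ,β,h)` tends to `0` as `Λ` tends to `V`"), `ghs_concaveOn_isingCorr_free_singleton`
  (Griffiths–Hurst–Sherman 1970: concavity of the finite-volume magnetisation in `h ≥ 0`),
  `freeCorr_singleton_tendsto_spontaneousMagnetization` (Friedli–Velenik 2017, Remark 3.30 with
  Prop. 3.29, Lemma 3.31 (1) and Thm. 3.25 (1): `lim_{h ↘ 0} ⟨σ₀⟩_{β,h} = m*(β)`), the latter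
  reduced in the appendix to `freeCorr_eq_plusCorr_singleton_of_pos` (Thm. 3.25 (1): free = plus
  one-point function at `h > 0`) by proving the right-continuity of `h ↦ ⟨σ_A⟩⁺_{β,h}`
  (`plusCorr_continuousWithinAt_Ici_field`, Lemma 3.31 (1)).

* proved tools: the one-site magnetisation `⟨σ_y⟩_{{y};β,h} = tanh(βh)`, positivity
  `⟨σ_y⟩_{Λ,β,h} ≥ tanh h`, eq. (2.10) (`dctMag_div_le_dctRatioConst`, by translation covariance
  `isingCorr_free_map` and GKS volume monotonicity), the field derivative
  `d/dh ⟨f⟩ = β(⟨fM_Λ⟩ - ⟨f⟩⟨M_Λ⟩)` (`hasDerivAt_isingExpect_field`), the susceptibility bound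
  `∑_x ⟨σ₀;σ_x⟩ ≤ 2/(βh)` from concavity, `0 ≤ ε(Λ,β,h) ≤ 8d/h`, `c(Λ_n) → 1`, a one-sided
  Grönwall lemma with variable coefficients, and the two dominated-convergence passages.

## The assembly (proved: `one_sub_dctMag_sq_le`, `one_sub_dctMagInf_sq_le`,
## `dct_magnetization_lower_bound_of_facts`)

For `0 < β₁ < β₁' < β`, `h > 0` and the boxes `Λ_n`: with `f_n(s) = ⟨σ₀⟩²_{Λ_n,s,h}` and
`g_n = 1 - f_n`, Lemma 2.6 with `inf_{S ∋ 0} φ_s(S) ≥ 1` for `s > β₁` gives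
`g_n' ≤ -(2c_n(s)/s) g_n + ε_n(s)` on `[β₁', β]`, whence
`g_n(β) ≤ exp(-∫_{β₁'}^{β} 2c_n(u)/u du) + ∫_{β₁'}^{β} ε_n(u) du`. As `n → ∞`: `c_n(u) → 1`
pointwise with `0 ≤ c_n ≤ 1` (eq. (2.10): `c(Λ_n) ≥ ⟨σ₀⟩_{Λ_n}/⟨σ₀⟩_{Λ_{2n}}`, GKS volume
monotonicity with field and translation covariance, and `⟨σ₀⟩_{Λ_n,u,h} → ⟨σ₀⟩_{u,h} > 0`);
`ε_n(u) → 0` pointwise (the 2018 correction) with the uniform bound `0 ≤ ε_n(u) ≤ 8d/h` (GKS II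
and the GHS concavity: `∑_{x} ⟨σ₀;σ_x⟩_{Λ,u,h} = ∂_h ⟨σ₀⟩_{Λ,u,h} ≤ 2/h`), so both integrals
pass to the limit by dominated convergence: `⟨σ₀⟩²_{β,h} ≥ 1 - (β₁'/β)²` for every
`β₁' ∈ (β₁, β)` and `h > 0`; finally `h ↘ 0`.

## References

* H. Duminil-Copin, V. Tassion, CMP 343 (2016) 725, §2.4, Lemma 2.6, eqs. (2.6)–(2.10)
  (arXiv:1502.03050 numbering); Correction, CMP 359 (2018) 821.
* R. B. Griffiths, C. A. Hurst, S. Sherman, J. Math. Phys. 11 (1970) 790 (GHS inequality).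
* S. Friedli, Y. Velenik, *Statistical Mechanics of Lattice Systems*, CUP 2017, §3.7:
  Prop. 3.29, Remark 3.30, Lemma 3.31, Thm. 3.25, Remark 3.41.
-/

noncomputable section

open Finset Filter Topology MeasureTheory Literature.Probability.LatticeModels Literature.Probability.Percolation Set intervalIntegral
open scoped symmDiff

namespace Literature.Probability.LatticeModels

variable {d : ℕ}

/-! ### Duminil-Copin–Tassion's finite-volume quantities -/

variable (d) in
/-- DCT's finite-volume free state `⟨σ_A⟩_{Λ,β,h}` with weights `exp(β ∑_{xy} σ_xσ_y + h ∑_x σ_x)`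
(Duminil-Copin–Tassion 2016, §2.1 "Notation"), expressed through the tree's `isingCorr` at
field `h/β` (the tree's field enters as `βh`); meaningful for `β > 0`. [cite: DuminilCopinTassionCMP2016, §2.1 (arXiv:1502.03050 numbering)] -/
def dctCorr (Λ : Finset (Site d)) (β h : ℝ) (A : Finset (Site d)) : ℝ :=
  isingCorr (zdGraph d) Λ β (h / β) .free A

variable (d) in
/-- DCT's finite-volume magnetisation `⟨σ₀⟩_{Λ,β,h}`. [cite: DuminilCopinTassionCMP2016, §2.4 (arXiv:1502.03050 numbering)] -/
def dctMag (Λ : Finset (Site d)) (β h : ℝ) : ℝ :=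
  dctCorr d Λ β h {0}

variable (d) in
/-- DCT's `c(Λ) := min_{y ∈ Λ} ⟨σ₀⟩_{Λ,β,h} / ⟨σ_y⟩_{Λ,β,h}` (Duminil-Copin–Tassion 2016, §2.4,
display before Lemma 2.6), as the infimum of the finite set of ratios (`= 0` if `Λ = ∅`). [cite: DuminilCopinTassionCMP2016, §2.4, definition of c(Λ) (arXiv:1502.03050 numbering)] -/
def dctRatioConst (Λ : Finset (Site d)) (β h : ℝ) : ℝ :=
  sInf ((fun y => dctMag d Λ β h / dctCorr d Λ β h {y}) '' (Λ : Set (Site d)))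

variable (d) in
/-- The correcting boundary term of the 2018 correction,
`ε(Λ,β,h) := 2 ∑_{x ∈ Λ} ∑_{y ∈ V ∖ Λ} J_{x,y} (⟨σ₀σ_x⟩_{Λ,β,h} - ⟨σ₀⟩_{Λ,β,h}⟨σ_x⟩_{Λ,β,h})`,
for the nearest-neighbour coupling `J_{xy} = 1_{x ∼ y}` on `ℤ^d` (so `y` ranges over the
neighbours of `x` outside `Λ`); `⟨σ₀σ_x⟩ = ⟨σ_{{0} ∆ {x}}⟩`. [cite: DuminilCopinTassionCMP2016, Correction CMP 359 (2018) 821, definition of ε(Λ,β,h)] -/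
def dctBoundaryError (Λ : Finset (Site d)) (β h : ℝ) : ℝ :=
  2 * ∑ x ∈ Λ, ∑ _y ∈ ((zdGraph d).neighborFinset x).filter (fun y => y ∉ Λ),
    (dctCorr d Λ β h ({0} ∆ {x}) - dctMag d Λ β h * dctCorr d Λ β h {x})

/-- Unfolding of `dctCorr`. [folklore] -/
theorem dctCorr_def (Λ : Finset (Site d)) (β h : ℝ) (A : Finset (Site d)) :
    dctCorr d Λ β h A = isingCorr (zdGraph d) Λ β (h / β) .free A := rfl

/-- Unfolding of `dctMag`. [folklore] -/
theorem dctMag_def (Λ : Finset (Site d)) (β h : ℝ) :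
    dctMag d Λ β h = isingCorr (zdGraph d) Λ β (h / β) .free {0} := rfl

/-- At zero field DCT's state is the tree's free state at zero field. [folklore] -/
theorem dctCorr_zero_field (Λ : Finset (Site d)) (β : ℝ) (A : Finset (Site d)) :
    dctCorr d Λ β 0 A = isingCorr (zdGraph d) Λ β 0 .free A := by
  rw [dctCorr, zero_div]

/-! ### The named facts -/

/-- **Duminil-Copin–Tassion 2016, Lemma 2.6, as corrected in CMP 359 (2018) 821** (the
mean-field differential inequality). "Let `β > 0`, `h > 0`, and `Λ ⊂ V` finite containing `0`.
Then `d/dβ ⟨σ₀⟩²_{Λ,β,h} ≥ (2c(Λ)/β) (inf_{S ∋ 0} φ_β(S)) (1 - ⟨σ₀⟩²_{Λ,β,h}) - ε(Λ,β,h)`",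
with `c(Λ) = min_{y ∈ Λ} ⟨σ₀⟩_{Λ,β,h}/⟨σ_y⟩_{Λ,β,h}`, `φ_β(S)` of eq. (2.1) (`dctIsingPhi`, the
infimum running over all finite `S ∋ 0`) and the correcting term `ε(Λ,β,h)` of the 2018
correction (`dctBoundaryError`). Here for the nearest-neighbour model on `ℤ^d`, `d ≥ 1`, with
the derivative taken in DCT's parametrisation (`dctMag`, field `h` fixed). [cite: DuminilCopinTassionCMP2016, Lemma 2.6 (arXiv:1502.03050 numbering), with the Correction CMP 359 (2018) 821] -/
def dct_meanField_differentialInequality : Prop :=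
  ∀ (_ : 1 ≤ d) {β h : ℝ}, 0 < β → 0 < h → ∀ {Λ : Finset (Site d)}, (0 : Site d) ∈ Λ →
    (2 * dctRatioConst d Λ β h / β) *
          (⨅ S : {S : Finset (Site d) // (0 : Site d) ∈ S}, dctIsingPhi d β S.1) *
        (1 - dctMag d Λ β h ^ 2) - dctBoundaryError d Λ β h
      ≤ deriv (fun β' => dctMag d Λ β' h ^ 2) β

/-- **Duminil-Copin–Tassion, Correction CMP 359 (2018) 821**: "the GHS inequality [GHS70]
classically implies that `ε(Λ,β,h)` tends to `0` as `Λ` tends to `V`"; here along the boxes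
`Λ_n = [-n,n]^d` of `ℤ^d`, `d ≥ 1`, for `β > 0` and `h > 0`. [cite: DuminilCopinTassionCMP2016, Correction CMP 359 (2018) 821 (ε(Λ,β,h) → 0 by the GHS inequality)] [cite: GriffithsHurstSherman1970, Thm. 1] -/
def dct_boundaryError_tendsto_zero : Prop :=
  ∀ (_ : 1 ≤ d) {β h : ℝ}, 0 < β → 0 < h →
    Tendsto (fun n : ℕ => dctBoundaryError d (box d n) β h) atTop (𝓝 0)

/-- **GHS concavity of the finite-volume magnetisation** (Griffiths–Hurst–Sherman, J. Math.
Phys. 11 (1970) 790, Thm. 1: `u₃(x,y,z) ≤ 0` for non-negative fields, hence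
`∂²⟨σ_x⟩/∂h² ≤ 0` on `h ≥ 0`; Friedli–Velenik 2017, Remark 3.41: "the GHS inequality can be
used to show that the magnetization `h ↦ ⟨σ₀⟩_{β,h}` is concave"). For the nearest-neighbour
Ising model with free boundary condition in a finite volume `Λ` of a locally finite graph,
`β ≥ 0` and `x ∈ Λ`, the one-point function `h ↦ ⟨σ_x⟩^∅_{Λ;β,h}` is concave on `[0, ∞)`
(tree parametrisation; concavity is invariant under `h ↦ βh`). [cite: GriffithsHurstSherman1970, Thm. 1 (GHS inequality; concavity of the magnetisation in h ≥ 0)] -/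
def ghs_concaveOn_isingCorr_free_singleton : Prop :=
  ∀ {V : Type} [DecidableEq V] (G : SimpleGraph V) [G.LocallyFinite] (Λ : Finset V) {x : V},
    x ∈ Λ → ∀ {β : ℝ}, 0 ≤ β →
      ConcaveOn ℝ (Set.Ici (0 : ℝ)) (fun h : ℝ => isingCorr G Λ β h .free {x})

/-- **`lim_{h ↘ 0} ⟨σ₀⟩_{β,h} = m*(β)`** (Friedli–Velenik 2017, Remark 3.30:
"`m*(β) = lim_{h↓0} m(β,h) = lim_{h↓0} m⁺(β,h) = m⁺(β,0) = ⟨σ₀⟩⁺_{β,0}`", with Prop. 3.29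
(`m⁺(β,h) = ⟨σ₀⟩⁺_{β,h}`), Lemma 3.31 (1) (right-continuity of `h ↦ ⟨σ₀⟩⁺_{β,h}`) and
Thm. 3.25 (1) (uniqueness, hence `⟨σ₀⟩^∅_{β,h} = ⟨σ₀⟩⁺_{β,h}`, for `h ≠ 0`)). For the
nearest-neighbour Ising model on `ℤ^d`, `d ≥ 1`, and `β ≥ 0`: the free-state magnetisation
`⟨σ₀⟩^∅_{β,h}` (`freeCorr d β h {0}`, tree parametrisation of the field) tends to the
spontaneous magnetisation `m*(β) = ⟨σ₀⟩⁺_{β,0}` as `h ↘ 0`. [cite: FriedliVelenik2017, Remark 3.30 with Prop. 3.29, Lemma 3.31 (1) and Thm. 3.25 (1), pp. 116–119] -/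
def freeCorr_singleton_tendsto_spontaneousMagnetization : Prop :=
  ∀ (_ : 1 ≤ d) {β : ℝ}, 0 ≤ β →
    Tendsto (fun h : ℝ => freeCorr d β h {0}) (𝓝[>] 0) (𝓝 (spontaneousMagnetization d β))

/-! ### Real analysis for the assembly: a one-sided Grönwall bound -/

section Gronwall

open Set intervalIntegral

/-- **A one-sided Grönwall bound with variable coefficients.** If `g` is continuous on `[a, b]`,
differentiable on `(a, b)` with `g'(s) ≤ -k(s) g(s) + e(s)` there, where `k ≥ 0` and `e` are
continuous on `[a, b]`, then
`g(b) ≤ g(a) exp(-∫_a^b k) + ∫_a^b max(e, 0)`.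
(Multiply by the integrating factor `exp(∫_a^s k)` and compare.) [folklore] -/
theorem le_mul_exp_neg_integral_add_of_deriv_le {a b : ℝ} (hab : a ≤ b) {g g' k e : ℝ → ℝ}
    (hgc : ContinuousOn g (Icc a b)) (hg : ∀ s ∈ Ioo a b, HasDerivAt g (g' s) s)
    (hkc : ContinuousOn k (Icc a b)) (hec : ContinuousOn e (Icc a b))
    (hk : ∀ s ∈ Icc a b, 0 ≤ k s)
    (hineq : ∀ s ∈ Ioo a b, g' s ≤ -k s * g s + e s) :
    g b ≤ g a * Real.exp (-∫ u in a..b, k u) + ∫ u in a..b, max (e u) 0 := by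
  -- the integrating factor
  set K : ℝ → ℝ := fun s => ∫ u in a..s, k u with hK
  set E : ℝ → ℝ := fun s => Real.exp (K s) with hE
  have haI : a ∈ Icc a b := left_mem_Icc.2 hab
  have hbI : b ∈ Icc a b := right_mem_Icc.2 hab
  have hk_int : ∀ s ∈ Icc a b, IntervalIntegrable k volume a s := fun s hs =>
    (hkc.mono (uIcc_subset_Icc haI hs)).intervalIntegrable
  have hKc : ContinuousOn K (Icc a b) := by
    have := intervalIntegral.continuousOn_primitive_interval (μ := volume) (f := k) (a := a)
      (b := b) ((hkc.mono (uIcc_subset_Icc haI hbI)).integrableOn_compact isCompact_uIcc)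
    simpa only [hK, uIcc_of_le hab] using this
  have hEc : ContinuousOn E (Icc a b) := Real.continuous_exp.comp_continuousOn hKc
  have hKderiv : ∀ s ∈ Ioo a b, HasDerivAt K (k s) s := by
    intro s hs
    have hsI : Icc a b ∈ 𝓝 s := Icc_mem_nhds hs.1 hs.2
    refine intervalIntegral.integral_hasDerivAt_right (hk_int s (Ioo_subset_Icc_self hs)) ?_
      (hkc.continuousAt hsI)
    exact (hkc.mono Ioo_subset_Icc_self).stronglyMeasurableAtFilter isOpen_Ioo s hs
  have hEderiv : ∀ s ∈ Ioo a b, HasDerivAt E (k s * E s) s := by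
    intro s hs
    have := (hKderiv s hs).exp
    simpa only [hE, mul_comm] using this
  -- monotonicity of `K` and bounds on `E`
  have hKmono : ∀ s ∈ Icc a b, K s ≤ K b := by
    intro s hs
    have hadd : K s + ∫ u in s..b, k u = K b :=
      intervalIntegral.integral_add_adjacent_intervals (hk_int s hs)
        ((hkc.mono (uIcc_subset_Icc hs hbI)).intervalIntegrable)
    have hnn : 0 ≤ ∫ u in s..b, k u :=
      intervalIntegral.integral_nonneg hs.2 fun u hu => hk u ⟨hs.1.trans hu.1, hu.2⟩
    linarith
  have hKa : K a = 0 := by simp [hK]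
  have hK0 : ∀ s ∈ Icc a b, 0 ≤ K s := fun s hs =>
    intervalIntegral.integral_nonneg hs.1 fun u hu => hk u ⟨hu.1, hu.2.trans hs.2⟩
  have hEpos : ∀ s, 0 < E s := fun s => Real.exp_pos _
  have hEle : ∀ s ∈ Icc a b, E s ≤ E b := fun s hs => Real.exp_le_exp.2 (hKmono s hs)
  have hEa : E a = 1 := by simp [hE, hKa]
  -- the positive part of `e` and its weighted primitive
  set ep : ℝ → ℝ := fun u => max (e u) 0 with hep
  have hepc : ContinuousOn ep (Icc a b) := fun x hx => (hec x hx).max continuousWithinAt_const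
  have hepE : ContinuousOn (fun u => ep u * E u) (Icc a b) := hepc.mul hEc
  set P : ℝ → ℝ := fun s => ∫ u in a..s, ep u * E u with hP
  have hP_int : ∀ s ∈ Icc a b, IntervalIntegrable (fun u => ep u * E u) volume a s := fun s hs =>
    (hepE.mono (uIcc_subset_Icc haI hs)).intervalIntegrable
  have hPc : ContinuousOn P (Icc a b) := by
    have := intervalIntegral.continuousOn_primitive_interval (μ := volume)
      (f := fun u => ep u * E u) (a := a) (b := b)
      ((hepE.mono (uIcc_subset_Icc haI hbI)).integrableOn_compact isCompact_uIcc)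
    simpa only [hP, uIcc_of_le hab] using this
  have hPderiv : ∀ s ∈ Ioo a b, HasDerivAt P (ep s * E s) s := by
    intro s hs
    have hsI : Icc a b ∈ 𝓝 s := Icc_mem_nhds hs.1 hs.2
    refine intervalIntegral.integral_hasDerivAt_right (hP_int s (Ioo_subset_Icc_self hs)) ?_
      (hepE.continuousAt hsI)
    exact (hepE.mono Ioo_subset_Icc_self).stronglyMeasurableAtFilter isOpen_Ioo s hs
  -- the comparison function `H = g E - P` is nonincreasing
  set H : ℝ → ℝ := fun s => g s * E s - P s with hH
  have hHanti : AntitoneOn H (Icc a b) := by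
    refine antitoneOn_of_hasDerivWithinAt_nonpos (convex_Icc a b) ((hgc.mul hEc).sub hPc)
      (f' := fun s => g' s * E s + g s * (k s * E s) - ep s * E s) ?_ ?_
    · intro s hs
      rw [interior_Icc] at hs
      exact (((hg s hs).mul (hEderiv s hs)).sub (hPderiv s hs)).hasDerivWithinAt
    · intro s hs
      rw [interior_Icc] at hs
      have h1 := hineq s hs
      have h2 : e s ≤ ep s := le_max_left _ _
      have hE0 := (hEpos s).le
      nlinarith [mul_le_mul_of_nonneg_right (show g' s + k s * g s ≤ ep s by linarith) hE0]
  have hHab : H b ≤ H a := hHanti haI hbI hab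
  have hPa : P a = 0 := by simp [hP]
  have hPb : P b ≤ E b * ∫ u in a..b, ep u := by
    rw [← intervalIntegral.integral_const_mul]
    refine intervalIntegral.integral_mono_on hab (hP_int b hbI)
      ((hepc.mono (uIcc_subset_Icc haI hbI)).intervalIntegrable.const_mul (E b)) fun u hu => ?_
    rw [mul_comm (E b)]
    exact mul_le_mul_of_nonneg_left (hEle u hu) (le_max_right _ _)
  -- conclusion
  have hEb := hEpos b
  have hmain : g b * E b ≤ g a + E b * ∫ u in a..b, ep u := by
    have : H b = g b * E b - P b := rfl
    have : H a = g a := by simp only [hH, hEa, hPa, mul_one, sub_zero]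
    linarith
  have hexp : Real.exp (-∫ u in a..b, k u) = (E b)⁻¹ := by
    rw [Real.exp_neg]
  rw [hexp]
  have h1 : g b = (g b * E b) / E b := by field_simp
  have h2 : (g a + E b * ∫ u in a..b, ep u) / E b = g a * (E b)⁻¹ + ∫ u in a..b, ep u := by
    field_simp
  rw [h1, ← h2]
  exact div_le_div_of_nonneg_right hmain hEb.le

end Gronwall




/-! ### Finite-volume tools for the assembly -/

section FiniteVolumeTools

/-- A site of `ℤ^d` has at most `2d` neighbours. [folklore] -/
theorem card_neighborFinset_zdGraph_le (x : Site d) : #((zdGraph d).neighborFinset x) ≤ 2 * d := by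
  classical
  have hsub : (zdGraph d).neighborFinset x ⊆
      (univ : Finset (Fin d × Bool)).image
        (fun p => if p.2 then x + Pi.single p.1 1 else x - Pi.single p.1 1) := by
    intro y hy
    rw [SimpleGraph.mem_neighborFinset] at hy
    obtain ⟨i, h | h⟩ := (zdGraph_adj_iff x y).1 hy
    · exact mem_image.2 ⟨(i, true), mem_univ _, by simp [h]⟩
    · exact mem_image.2 ⟨(i, false), mem_univ _, by simp [h]⟩
  calc #((zdGraph d).neighborFinset x)
      ≤ #((univ : Finset (Fin d × Bool)).image
          (fun p => if p.2 then x + Pi.single p.1 1 else x - Pi.single p.1 1)) := card_le_card hsub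
    _ ≤ #(univ : Finset (Fin d × Bool)) := card_image_le
    _ = 2 * d := by simp [mul_comm]

/-- DCT's finite-volume correlations are continuous in `β` on `(0, ∞)` (joint continuity of the
finite-volume Gibbs averages in `(β, h)`, `continuous_isingExpect_param`). [folklore] -/
theorem continuousOn_dctCorr (Λ : Finset (Site d)) (h : ℝ) (A : Finset (Site d)) :
    ContinuousOn (fun s => dctCorr d Λ s h A) (Ioi 0) := by
  have hc := continuous_isingExpect_param (zdGraph d) Λ .free (measurable_spinProduct A)
  have hpath : ContinuousOn (fun s : ℝ => (s, h / s)) (Ioi 0) :=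
    continuousOn_id.prodMk (continuousOn_const.div continuousOn_id fun s hs => ne_of_gt hs)
  have hform : (fun s => dctCorr d Λ s h A) =
      (fun p : ℝ × ℝ => isingExpect (zdGraph d) Λ p.1 p.2 .free (spinProduct A)) ∘
        fun s : ℝ => (s, h / s) := by
    funext s
    rfl
  rw [hform]
  exact hc.comp_continuousOn hpath

/-- DCT's finite-volume correlations are differentiable in `β` away from `0`. [folklore] -/
theorem differentiableAt_dctCorr (Λ : Finset (Site d)) {s : ℝ} (hs : s ≠ 0) (h : ℝ)
    (A : Finset (Site d)) : DifferentiableAt ℝ (fun s => dctCorr d Λ s h A) s := by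
  have hform : (fun s => dctCorr d Λ s h A) = fun s =>
      (∑ τ : Λ → ℤˣ, isingWeight (zdGraph d) Λ s (h / s) .free τ * spinProduct A (glue Λ τ .free)) /
        isingPartitionFunction (zdGraph d) Λ s (h / s) .free := by
    funext s
    exact isingExpect_eq_sum_div (zdGraph d) Λ (h / s) .free s (measurable_spinProduct A)
  rw [hform]
  have hw : ∀ τ : Λ → ℤˣ,
      DifferentiableAt ℝ (fun s => isingWeight (zdGraph d) Λ s (h / s) .free τ) s := by
    intro τ
    unfold isingWeight isingHamiltonian
    fun_prop (disch := exact hs)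
  refine DifferentiableAt.div ?_ ?_ (isingPartitionFunction_pos _ _ _ _ _).ne'
  · exact DifferentiableAt.fun_sum fun τ _ => (hw τ).mul_const _
  · unfold isingPartitionFunction
    exact DifferentiableAt.fun_sum fun τ _ => hw τ

/-- The squared finite-volume magnetisation is differentiable in `β` away from `0`. [folklore] -/
theorem differentiableAt_dctMag_sq (Λ : Finset (Site d)) {s : ℝ} (hs : s ≠ 0) (h : ℝ) :
    DifferentiableAt ℝ (fun s => dctMag d Λ s h ^ 2) s :=
  (differentiableAt_dctCorr Λ hs h {0}).pow 2

/-- **The one-site magnetisation**: `⟨σ_y⟩^∅_{{y};β,h} = tanh(βh)` (there are no edges inside a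
single site; tree parametrisation of the field). [folklore] -/
theorem isingCorr_free_singleton_self (y : Site d) (β h : ℝ) :
    isingCorr (zdGraph d) {y} β h .free {y} = Real.tanh (β * h) := by
  have hE : edgesIn (zdGraph d) ({y} : Finset (Site d)) = ∅ := by
    refine eq_empty_iff_forall_notMem.2 fun e he => ?_
    rw [mem_edgesIn_iff] at he
    induction e using Sym2.ind with
    | _ a b =>
      have hab : a ≠ b := (zdGraph d).ne_of_adj ((SimpleGraph.mem_edgeSet _).1 he.1)
      have ha : a = y := mem_singleton.1 (he.2 a (Sym2.mem_mk_left a b))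
      have hb : b = y := mem_singleton.1 (he.2 b (Sym2.mem_mk_right a b))
      exact hab (ha.trans hb.symm)
  have hy : y ∈ ({y} : Finset (Site d)) := mem_singleton_self y
  rw [isingCorr, isingExpect_eq_sum_div (zdGraph d) {y} h .free β (measurable_spinProduct _)]
  -- reindex the sum over configurations on `{y}` by the value at `y`
  set e : ℤˣ ≃ (({y} : Finset (Site d)) → ℤˣ) :=
    { toFun := fun u _ => u
      invFun := fun τ => τ ⟨y, hy⟩
      left_inv := fun u => rfl
      right_inv := fun τ => funext fun x => by
        have hx : x = ⟨y, hy⟩ := Subtype.ext (mem_singleton.1 x.2)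
        simp [hx] } with he
  have hw : ∀ u : ℤˣ, isingWeight (zdGraph d) {y} β h .free (e u) = Real.exp (β * h * (u : ℤ)) := by
    intro u
    simp only [isingWeight, isingHamiltonian, interactionEdges_free, hE, sum_empty, neg_zero,
      zero_sub, sum_singleton, spinAt, glue_apply_of_mem _ _ _ hy, he, Equiv.coe_fn_mk]
    congr 1
    ring
  have hs : ∀ u : ℤˣ, spinProduct {y} (glue {y} (e u) .free) = (u : ℤ) := by
    intro u
    simp [spinProduct, spinAt, he]
  have huniv : (univ : Finset ℤˣ) = {1, -1} := by
    ext u; simp [Int.units_eq_one_or u]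
  rw [isingPartitionFunction, ← Equiv.sum_comp e, ← Equiv.sum_comp e]
  simp only [hw, hs, huniv]
  rw [sum_pair (by decide), sum_pair (by decide)]
  simp only [Units.val_one, Units.val_neg, Int.cast_one, Int.cast_neg, mul_one, mul_neg]
  rw [Real.tanh_eq_sinh_div_cosh, Real.sinh_eq, Real.cosh_eq]
  field_simp
  ring

/-- The one-site DCT magnetisation: `⟨σ_y⟩_{{y},β,h} = tanh h` for `β ≠ 0`. [folklore] -/
theorem dctCorr_singleton_self {y : Site d} {β : ℝ} (hβ : β ≠ 0) (h : ℝ) :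
    dctCorr d {y} β h {y} = Real.tanh h := by
  rw [dctCorr, isingCorr_free_singleton_self, mul_div_cancel₀ _ hβ]

/-- GKS data used repeatedly: GKS I and II for every locally finite graph on `ℤ^d` (proved in the
tree: `Literature.Probability.LatticeModels.GKSInequalities.gks_one_holds`, `Literature.Probability.LatticeModels.GKSInequalities.gks_two_holds`). [cite: KellySherman1968] -/
theorem gks_two_all (G' : SimpleGraph (Site d)) [G'.LocallyFinite] (Λ A B : Finset (Site d))
    (β h : ℝ) (bc : BoundaryCondition (Site d)) :
    gks_two G' (Λ := Λ) (A := A) (B := B) (β := β) (h := h) (bc := bc) :=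
  Literature.Probability.LatticeModels.GKSInequalities.gks_two_holds G'

/-- **Positivity in a field**: `tanh h ≤ ⟨σ_y⟩_{Λ,β,h}` for `y ∈ Λ`, `β > 0`, `h ≥ 0` (GKS volume
monotonicity from the single site `{y}`). [folklore] -/
theorem tanh_le_dctCorr_singleton {Λ : Finset (Site d)} {y : Site d} (hy : y ∈ Λ) {β h : ℝ}
    (hβ : 0 < β) (hh : 0 ≤ h) : Real.tanh h ≤ dctCorr d Λ β h {y} := by
  rw [← dctCorr_singleton_self (y := y) hβ.ne' h, dctCorr, dctCorr]
  exact isingCorr_free_mono_volume_of_gks_two gks_two_all hβ.le (div_nonneg hh hβ.le)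
    (singleton_subset_iff.2 (mem_singleton_self y)) (singleton_subset_iff.2 hy)

/-- `⟨σ_y⟩_{Λ,β,h} > 0` for `y ∈ Λ`, `β > 0`, `h > 0`. [folklore] -/
theorem dctCorr_singleton_pos {Λ : Finset (Site d)} {y : Site d} (hy : y ∈ Λ) {β h : ℝ}
    (hβ : 0 < β) (hh : 0 < h) : 0 < dctCorr d Λ β h {y} := by
  have htanh : 0 < Real.tanh h := by
    rw [Real.tanh_eq_sinh_div_cosh]
    exact div_pos (Real.sinh_pos_iff.2 hh) (Real.cosh_pos h)
  exact htanh.trans_le (tanh_le_dctCorr_singleton hy hβ hh.le)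

/-- `|⟨σ_A⟩_{Λ,β,h}| ≤ 1`. [folklore] -/
theorem abs_dctCorr_le_one (Λ : Finset (Site d)) (β h : ℝ) (A : Finset (Site d)) :
    |dctCorr d Λ β h A| ≤ 1 :=
  abs_isingCorr_le_one _ _ _ _ _ _

/-- **Translating a one-point function into a bigger box** (Duminil-Copin–Tassion 2016, proof of
(2.10): "`Λ_n ⊂ Λ_{2n}(y)`, Griffiths' inequality implies
`⟨σ_y⟩_{Λ_n,β,h} ≤ ⟨σ_y⟩_{Λ_{2n}(y),β,h} = ⟨σ₀⟩_{Λ_{2n},β,h}`"). [cite: DuminilCopinTassionCMP2016, §2.4, proof of eq. (2.10) (arXiv:1502.03050 numbering)] -/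
theorem dctCorr_singleton_le_dctMag_box {n : ℕ} {y : Site d} (hy : y ∈ box d n) {β h : ℝ}
    (hβ : 0 < β) (hh : 0 ≤ h) :
    dctCorr d (box d n) β h {y} ≤ dctMag d (box d (2 * n)) β h := by
  set φ : Site d ↪ Site d := ⟨fun x => x + y, add_left_injective y⟩ with hφ
  have hsub : box d n ⊆ (box d (2 * n)).map φ := by
    intro z hz
    refine mem_map.2 ⟨z - y, ?_, by simp [hφ]⟩
    rw [mem_box] at hz hy ⊢
    intro i
    have h1 := hz i; have h2 := hy i
    simp only [Pi.sub_apply, Nat.cast_mul, Nat.cast_ofNat]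
    constructor <;> linarith
  have hmap := isingCorr_free_map (G := zdGraph d) (G' := zdGraph d) φ (Λ := box d (2 * n))
    (fun a _ b _ => by simpa [hφ] using zdGraph_adj_shift_iff y a b) β (h / β)
    ({0} : Finset (Site d))
  rw [Finset.map_singleton] at hmap
  have hφ0 : φ 0 = y := by simp [hφ]
  rw [hφ0] at hmap
  rw [dctMag, dctCorr, dctCorr, ← hmap]
  exact isingCorr_free_mono_volume_of_gks_two gks_two_all hβ.le (div_nonneg hh hβ.le)
    (singleton_subset_iff.2 hy) hsub

/-- `c(Λ) ≤ 1` when `0 ∈ Λ` (the ratio at `y = 0`). [folklore] -/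
theorem dctRatioConst_le_one {Λ : Finset (Site d)} (h0 : (0 : Site d) ∈ Λ) (β h : ℝ) :
    dctRatioConst d Λ β h ≤ 1 := by
  unfold dctRatioConst
  have hbdd : BddBelow ((fun y => dctMag d Λ β h / dctCorr d Λ β h {y}) '' (Λ : Set (Site d))) :=
    (Set.Finite.image _ (finite_toSet Λ)).bddBelow
  refine (csInf_le hbdd (Set.mem_image_of_mem _ (mem_coe.2 h0))).trans ?_
  rw [dctMag]
  by_cases hz : dctCorr d Λ β h {0} = 0
  · rw [hz, div_zero]; exact zero_le_one
  · rw [div_self hz]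

/-- **Duminil-Copin–Tassion 2016, eq. (2.10)**: `⟨σ₀⟩_{Λ_n,β,h} / ⟨σ₀⟩_{Λ_{2n},β,h} ≤ c(Λ_n)`
for `β > 0`, `h > 0`. [cite: DuminilCopinTassionCMP2016, §2.4, eq. (2.10) (arXiv:1502.03050 numbering)] -/
theorem dctMag_div_le_dctRatioConst (n : ℕ) {β h : ℝ} (hβ : 0 < β) (hh : 0 < h) :
    dctMag d (box d n) β h / dctMag d (box d (2 * n)) β h ≤ dctRatioConst d (box d n) β h := by
  unfold dctRatioConst
  refine le_csInf ((coe_nonempty.2 (box_nonempty d n)).image _) ?_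
  rintro r ⟨y, hy, rfl⟩
  have hy' : y ∈ box d n := mem_coe.1 hy
  have hM0 : 0 ≤ dctMag d (box d n) β h := (dctCorr_singleton_pos (zero_mem_box d n) hβ hh).le
  exact div_le_div_of_nonneg_left hM0 (dctCorr_singleton_pos hy' hβ hh)
    (dctCorr_singleton_le_dctMag_box hy' hβ hh.le)

/-- `0 ≤ c(Λ_n)` for `β > 0`, `h > 0`. [folklore] -/
theorem dctRatioConst_nonneg (n : ℕ) {β h : ℝ} (hβ : 0 < β) (hh : 0 < h) :
    0 ≤ dctRatioConst d (box d n) β h :=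
  le_trans (div_nonneg (dctCorr_singleton_pos (zero_mem_box d n) hβ hh).le
    (dctCorr_singleton_pos (zero_mem_box d (2 * n)) hβ hh).le) (dctMag_div_le_dctRatioConst n hβ hh)

/-- The truncated two-point function `⟨σ₀σ_x⟩ - ⟨σ₀⟩⟨σ_x⟩ ≥ 0` in a field (GKS II). [folklore] -/
theorem dctCorr_trunc_nonneg {Λ : Finset (Site d)} (h0 : (0 : Site d) ∈ Λ) {x : Site d}
    (hx : x ∈ Λ) {β h : ℝ} (hβ : 0 ≤ β) (hh : 0 ≤ h) :
    0 ≤ dctCorr d Λ β h ({0} ∆ {x}) - dctMag d Λ β h * dctCorr d Λ β h {x} := by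
  rw [sub_nonneg, dctMag, dctCorr, dctCorr, dctCorr]
  exact gks_two_all (zdGraph d) Λ {0} {x} β (h / β) .free hβ (div_nonneg hh hβ) (Or.inl rfl)
    (singleton_subset_iff.2 h0) (singleton_subset_iff.2 hx)

/-- `ε(Λ,β,h) ≥ 0` for `β, h ≥ 0` and `0 ∈ Λ` (GKS II). [folklore] -/
theorem dctBoundaryError_nonneg {Λ : Finset (Site d)} (h0 : (0 : Site d) ∈ Λ) {β h : ℝ}
    (hβ : 0 ≤ β) (hh : 0 ≤ h) : 0 ≤ dctBoundaryError d Λ β h := by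
  unfold dctBoundaryError
  refine mul_nonneg zero_le_two (sum_nonneg fun x hx => sum_nonneg fun y _ => ?_)
  exact dctCorr_trunc_nonneg h0 hx hβ hh

/-- **The field derivative of finite-volume Gibbs averages**:
`d/dh ⟨f⟩^{bc}_{Λ;β,h} = β (⟨f M_Λ⟩ - ⟨f⟩⟨M_Λ⟩)` with `M_Λ = ∑_{x ∈ Λ} σ_x` (tree
parametrisation: the field enters as `βh`) (Friedli–Velenik 2017, proof of Lemma 3.31 (1),
first display). [cite: FriedliVelenik2017, Lemma 3.31 (1), proof (h-derivative of ⟨σ₀⟩), p. 119] -/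
theorem hasDerivAt_isingExpect_field {V : Type*} [DecidableEq V] (G : SimpleGraph V)
    [G.LocallyFinite] (Λ : Finset V) (β h : ℝ) (bc : BoundaryCondition V)
    {f : SpinConfig V → ℝ} (hf : Measurable f) :
    HasDerivAt (fun h => isingExpect G Λ β h bc f)
      (β * (isingExpect G Λ β h bc (fun σ => f σ * ∑ x ∈ Λ, spinAt x σ) -
        isingExpect G Λ β h bc f * isingExpect G Λ β h bc (fun σ => ∑ x ∈ Λ, spinAt x σ))) h := by
  have hM : Measurable fun σ : SpinConfig V => ∑ x ∈ Λ, spinAt x σ :=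
    Finset.measurable_sum _ fun x _ => measurable_spinAt x
  set Mτ : (Λ → ℤˣ) → ℝ := fun τ => ∑ x ∈ Λ, spinAt x (glue Λ τ bc) with hMτ
  set Sτ : (Λ → ℤˣ) → ℝ := fun τ => ∑ e ∈ interactionEdges G Λ bc, bondSpin (glue Λ τ bc) e
    with hSτ
  -- the weights as explicit exponentials of an affine function of `h`
  have hw_eq : ∀ τ : Λ → ℤˣ, (fun h => isingWeight G Λ β h bc τ) =
      fun h => Real.exp (β * Sτ τ + β * Mτ τ * h) := by
    intro τ; funext h
    simp only [isingWeight, isingHamiltonian, hSτ, hMτ]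
    congr 1; ring
  have hw : ∀ τ : Λ → ℤˣ, HasDerivAt (fun h => isingWeight G Λ β h bc τ)
      (β * Mτ τ * isingWeight G Λ β h bc τ) h := by
    intro τ
    have hwv : isingWeight G Λ β h bc τ = Real.exp (β * Sτ τ + β * Mτ τ * h) :=
      congrFun (hw_eq τ) h
    rw [hw_eq τ]
    have h1 : HasDerivAt (fun h => β * Sτ τ + β * Mτ τ * h) (β * Mτ τ) h := by
      simpa using ((hasDerivAt_id h).const_mul (β * Mτ τ)).const_add (β * Sτ τ)
    exact h1.exp.congr_deriv (by rw [hwv]; ring)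
  -- numerator and partition function
  have hN : HasDerivAt (fun h => ∑ τ : Λ → ℤˣ, isingWeight G Λ β h bc τ * f (glue Λ τ bc))
      (∑ τ : Λ → ℤˣ, β * Mτ τ * isingWeight G Λ β h bc τ * f (glue Λ τ bc)) h :=
    HasDerivAt.fun_sum fun τ _ => (hw τ).mul_const _
  have hZ : HasDerivAt (fun h => isingPartitionFunction G Λ β h bc)
      (∑ τ : Λ → ℤˣ, β * Mτ τ * isingWeight G Λ β h bc τ) h := by
    unfold isingPartitionFunction
    exact HasDerivAt.fun_sum fun τ _ => hw τ
  have hZpos := isingPartitionFunction_pos G Λ β h bc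
  have hform : (fun h => isingExpect G Λ β h bc f) = fun h =>
      (∑ τ : Λ → ℤˣ, isingWeight G Λ β h bc τ * f (glue Λ τ bc)) /
        isingPartitionFunction G Λ β h bc := by
    funext h
    exact isingExpect_eq_sum_div G Λ h bc β hf
  rw [hform]
  refine (hN.div hZ hZpos.ne').congr_deriv ?_
  -- identify the derivative
  have hfM : Measurable fun σ : SpinConfig V => f σ * ∑ x ∈ Λ, spinAt x σ := hf.mul hM
  rw [isingExpect_eq_sum_div G Λ h bc β hfM, isingExpect_eq_sum_div G Λ h bc β hf,
    isingExpect_eq_sum_div G Λ h bc β hM]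
  have h1 : ∑ τ : Λ → ℤˣ, β * Mτ τ * isingWeight G Λ β h bc τ * f (glue Λ τ bc) =
      β * ∑ τ : Λ → ℤˣ, isingWeight G Λ β h bc τ * (f (glue Λ τ bc) * Mτ τ) := by
    rw [mul_sum]; exact sum_congr rfl fun τ _ => by ring
  have h2 : ∑ τ : Λ → ℤˣ, β * Mτ τ * isingWeight G Λ β h bc τ =
      β * ∑ τ : Λ → ℤˣ, isingWeight G Λ β h bc τ * Mτ τ := by
    rw [mul_sum]; exact sum_congr rfl fun τ _ => by ring
  rw [h1, h2]
  field_simp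
  simp only [hMτ]
  ring

/-- **Susceptibility bound from GHS concavity**: granting the concavity of
`h ↦ ⟨σ₀⟩^∅_{Λ;β,h}` on `[0, ∞)` (GHS), for `β > 0`, `h > 0` and `0 ∈ Λ`,
`∑_{x ∈ Λ} (⟨σ₀σ_x⟩ - ⟨σ₀⟩⟨σ_x⟩)_{Λ;β,h} ≤ 2/(βh)`: the derivative `β ∑_x ⟨σ₀;σ_x⟩` of the
concave function at `h` is at most its secant slope from `0`, which is at most `2/h`. [folklore] -/
theorem sum_trunc_le_of_concave (hghs : ghs_concaveOn_isingCorr_free_singleton)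
    {Λ : Finset (Site d)} (h0 : (0 : Site d) ∈ Λ) {β k : ℝ} (hβ : 0 < β) (hk : 0 < k) :
    ∑ x ∈ Λ, (isingCorr (zdGraph d) Λ β k .free ({0} ∆ {x}) -
      isingCorr (zdGraph d) Λ β k .free {0} * isingCorr (zdGraph d) Λ β k .free {x}) ≤ 2 / (β * k) := by
  set φ : ℝ → ℝ := fun k => isingCorr (zdGraph d) Λ β k .free {0} with hφ
  have hconc : ConcaveOn ℝ (Set.Ici (0 : ℝ)) φ := hghs (zdGraph d) Λ h0 hβ.le
  -- the derivative of `φ` at `k`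
  have hderiv := hasDerivAt_isingExpect_field (zdGraph d) Λ β k .free (measurable_spinProduct {0})
  have hsum : isingExpect (zdGraph d) Λ β k .free
      (fun σ => spinProduct {0} σ * ∑ x ∈ Λ, spinAt x σ) =
      ∑ x ∈ Λ, isingCorr (zdGraph d) Λ β k .free ({0} ∆ {x}) := by
    have : (fun σ : SpinConfig (Site d) => spinProduct {0} σ * ∑ x ∈ Λ, spinAt x σ) =
        fun σ => ∑ x ∈ Λ, spinProduct ({0} ∆ {x}) σ := by
      funext σ
      rw [mul_sum]
      refine sum_congr rfl fun x _ => ?_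
      rw [show spinAt x σ = spinProduct {x} σ by simp [spinProduct], spinProduct_mul_spinProduct]
    rw [this, isingExpect_finset_sum' (zdGraph d) Λ k .free β _ _ fun x => measurable_spinProduct _]
    rfl
  have hmag : isingExpect (zdGraph d) Λ β k .free (fun σ => ∑ x ∈ Λ, spinAt x σ) =
      ∑ x ∈ Λ, isingCorr (zdGraph d) Λ β k .free {x} := by
    have : (fun σ : SpinConfig (Site d) => ∑ x ∈ Λ, spinAt x σ) =
        fun σ => ∑ x ∈ Λ, spinProduct {x} σ := by
      funext σ; exact sum_congr rfl fun x _ => by simp [spinProduct]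
    rw [this, isingExpect_finset_sum' (zdGraph d) Λ k .free β _ _ fun x => measurable_spinProduct _]
    rfl
  have hφ' : HasDerivAt φ (β * (∑ x ∈ Λ, isingCorr (zdGraph d) Λ β k .free ({0} ∆ {x}) -
      φ k * ∑ x ∈ Λ, isingCorr (zdGraph d) Λ β k .free {x})) k := by
    have := hderiv
    rw [hsum, hmag] at this
    exact this
  -- concavity: derivative ≤ secant slope from `0`
  have hslope := ConcaveOn.le_slope_of_hasDerivAt hconc (x := 0) (y := k) (Set.mem_Ici.2 le_rfl)
    (Set.mem_Ici.2 hk.le) hk hφ'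
  rw [slope_def_field, sub_zero] at hslope
  have hφ1 : |φ k| ≤ 1 := abs_isingCorr_le_one _ _ _ _ _ _
  have hφ0 : |φ 0| ≤ 1 := abs_isingCorr_le_one _ _ _ _ _ _
  have hnum : φ k - φ 0 ≤ 2 := by
    have := abs_le.1 hφ1; have := abs_le.1 hφ0; linarith
  have hsl : (φ k - φ 0) / k ≤ 2 / k := div_le_div_of_nonneg_right hnum hk.le
  have hrw : ∑ x ∈ Λ, (isingCorr (zdGraph d) Λ β k .free ({0} ∆ {x}) -
      isingCorr (zdGraph d) Λ β k .free {0} * isingCorr (zdGraph d) Λ β k .free {x}) =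
      ∑ x ∈ Λ, isingCorr (zdGraph d) Λ β k .free ({0} ∆ {x}) -
        φ k * ∑ x ∈ Λ, isingCorr (zdGraph d) Λ β k .free {x} := by
    rw [sum_sub_distrib, mul_sum]
  rw [hrw, le_div_iff₀ (mul_pos hβ hk)]
  have hk' : β * (∑ x ∈ Λ, isingCorr (zdGraph d) Λ β k .free ({0} ∆ {x}) -
      φ k * ∑ x ∈ Λ, isingCorr (zdGraph d) Λ β k .free {x}) ≤ 2 / k := hslope.trans hsl
  have := mul_le_mul_of_nonneg_right hk' hk.le
  rw [div_mul_cancel₀ _ hk.ne'] at this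
  linarith [this]

/-- **Uniform bound on the correcting term**: granting GHS concavity, for `β > 0`, `h > 0` and
`0 ∈ Λ ⊆ ℤ^d`, `ε(Λ,β,h) ≤ 8d/h` (each site has at most `2d` neighbours outside `Λ`, the truncated
functions are non-negative by GKS II, and `∑_x ⟨σ₀;σ_x⟩_{Λ,β,h} ≤ 2/h`). [folklore] -/
theorem dctBoundaryError_le (hghs : ghs_concaveOn_isingCorr_free_singleton)
    {Λ : Finset (Site d)} (h0 : (0 : Site d) ∈ Λ) {β h : ℝ} (hβ : 0 < β) (hh : 0 < h) :
    dctBoundaryError d Λ β h ≤ 8 * d / h := by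
  have hk : 0 < h / β := div_pos hh hβ
  have hsum := sum_trunc_le_of_concave hghs h0 hβ hk
  rw [mul_div_cancel₀ _ hβ.ne'] at hsum
  -- `hsum : ∑_x u₂(0,x) ≤ 2/h` in DCT's parametrisation
  have hsum' : ∑ x ∈ Λ, (dctCorr d Λ β h ({0} ∆ {x}) - dctMag d Λ β h * dctCorr d Λ β h {x}) ≤
      2 / h := hsum
  unfold dctBoundaryError
  calc 2 * ∑ x ∈ Λ, ∑ _y ∈ ((zdGraph d).neighborFinset x).filter (fun y => y ∉ Λ),
        (dctCorr d Λ β h ({0} ∆ {x}) - dctMag d Λ β h * dctCorr d Λ β h {x})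
      ≤ 2 * ∑ x ∈ Λ, (2 * d) *
          (dctCorr d Λ β h ({0} ∆ {x}) - dctMag d Λ β h * dctCorr d Λ β h {x}) := by
        refine mul_le_mul_of_nonneg_left (sum_le_sum fun x hx => ?_) zero_le_two
        rw [sum_const, nsmul_eq_mul]
        refine mul_le_mul_of_nonneg_right ?_ (dctCorr_trunc_nonneg h0 hx hβ.le hh.le)
        exact_mod_cast (card_filter_le _ _).trans (card_neighborFinset_zdGraph_le x)
    _ = 4 * d * ∑ x ∈ Λ, (dctCorr d Λ β h ({0} ∆ {x}) - dctMag d Λ β h * dctCorr d Λ β h {x}) := by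
        rw [← mul_sum]; ring
    _ ≤ 4 * d * (2 / h) := mul_le_mul_of_nonneg_left hsum' (by positivity)
    _ = 8 * d / h := by ring

end FiniteVolumeTools




/-! ### Limits `Λ_n ↑ ℤ^d` -/

section Limits

/-- The infinite-volume free-state magnetisation in DCT's parametrisation,
`M(β,h) := ⟨σ₀⟩^∅_{β,h/β}` (the box limit of `dctMag`). [folklore] -/
def dctMagInf (d : ℕ) (β h : ℝ) : ℝ := freeCorr d β (h / β) {0}

/-- `⟨σ₀⟩_{Λ_n,β,h} → M(β,h)` (existence of the free state, `hasBoxLimit_isingCorr_free`, proved in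
the tree). [folklore] -/
theorem tendsto_dctMag_box {β h : ℝ} (hβ : 0 < β) (hh : 0 ≤ h) :
    Tendsto (fun n : ℕ => dctMag d (box d n) β h) atTop (𝓝 (dctMagInf d β h)) :=
  Literature.Probability.LatticeModels.hasBoxLimit_isingCorr_free_holds hβ.le (div_nonneg hh hβ.le) {0}

/-- `M(β,h) ≥ tanh h > 0` for `β > 0`, `h > 0`. [folklore] -/
theorem tanh_le_dctMagInf {β h : ℝ} (hβ : 0 < β) (hh : 0 ≤ h) : Real.tanh h ≤ dctMagInf d β h :=
  ge_of_tendsto' (tendsto_dctMag_box hβ hh) fun n =>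
    tanh_le_dctCorr_singleton (zero_mem_box d n) hβ hh

/-- `M(β,h) > 0` for `β > 0`, `h > 0`. [folklore] -/
theorem dctMagInf_pos {β h : ℝ} (hβ : 0 < β) (hh : 0 < h) : 0 < dctMagInf d β h := by
  have htanh : 0 < Real.tanh h := by
    rw [Real.tanh_eq_sinh_div_cosh]
    exact div_pos (Real.sinh_pos_iff.2 hh) (Real.cosh_pos h)
  exact htanh.trans_le (tanh_le_dctMagInf hβ hh.le)

/-- **`c(Λ_n) → 1`** (from eq. (2.10) and the existence and positivity of the infinite-volume
magnetisation at `h > 0`). [cite: DuminilCopinTassionCMP2016, §2.4, eqs. (2.9)–(2.10) and the following display (arXiv:1502.03050 numbering)] -/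
theorem tendsto_dctRatioConst_box {β h : ℝ} (hβ : 0 < β) (hh : 0 < h) :
    Tendsto (fun n : ℕ => dctRatioConst d (box d n) β h) atTop (𝓝 1) := by
  have hM := tendsto_dctMag_box (d := d) hβ hh.le
  have h2 : Tendsto (fun n : ℕ => dctMag d (box d (2 * n)) β h) atTop (𝓝 (dctMagInf d β h)) :=
    hM.comp (tendsto_id.const_mul_atTop' two_pos)
  have hratio : Tendsto (fun n : ℕ => dctMag d (box d n) β h / dctMag d (box d (2 * n)) β h) atTop
      (𝓝 1) := by
    have := hM.div h2 (dctMagInf_pos hβ hh).ne'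
    rwa [div_self (dctMagInf_pos hβ hh).ne'] at this
  exact tendsto_of_tendsto_of_tendsto_of_le_of_le hratio tendsto_const_nhds
    (fun n => dctMag_div_le_dctRatioConst n hβ hh)
    (fun n => dctRatioConst_le_one (zero_mem_box d n) β h)

/-- `c(Λ)` as a finite infimum. [folklore] -/
theorem dctRatioConst_eq_inf' {Λ : Finset (Site d)} (hΛ : Λ.Nonempty) (β h : ℝ) :
    dctRatioConst d Λ β h = Λ.inf' hΛ (fun y => dctMag d Λ β h / dctCorr d Λ β h {y}) := by
  rw [dctRatioConst, Finset.inf'_eq_csInf_image]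

/-- Continuity of `β ↦ c(Λ)(β, h)` on `(0, ∞)` for `h > 0`. [folklore] -/
theorem continuousOn_dctRatioConst {Λ : Finset (Site d)} (hΛ : Λ.Nonempty) {h : ℝ} (hh : 0 < h) :
    ContinuousOn (fun s => dctRatioConst d Λ s h) (Ioi 0) := by
  have hform : (fun s => dctRatioConst d Λ s h) =
      fun s => Λ.inf' hΛ (fun y => dctMag d Λ s h / dctCorr d Λ s h {y}) :=
    funext fun s => dctRatioConst_eq_inf' hΛ s h
  rw [hform]
  refine ContinuousOn.finset_inf'_apply hΛ fun y hy => ?_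
  refine (continuousOn_dctCorr Λ h {0}).div (continuousOn_dctCorr Λ h {y}) fun s hs => ?_
  exact (dctCorr_singleton_pos hy hs hh).ne'

/-- Continuity of `β ↦ ε(Λ,β,h)` on `(0, ∞)`. [folklore] -/
theorem continuousOn_dctBoundaryError (Λ : Finset (Site d)) (h : ℝ) :
    ContinuousOn (fun s => dctBoundaryError d Λ s h) (Ioi 0) := by
  unfold dctBoundaryError dctMag
  refine continuousOn_const.mul (continuousOn_finsetSum _ fun x _ => ?_)
  refine continuousOn_finsetSum _ fun y _ => ?_
  exact (continuousOn_dctCorr Λ h _).sub ((continuousOn_dctCorr Λ h _).mul (continuousOn_dctCorr Λ h _))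

end Limits

/-! ### The assembly: eq. (2.6) from the named facts -/

section Assembly

/-- **Integration of the differential inequality in a box** (Duminil-Copin–Tassion 2016, §2.4,
(2.8)–(2.9), with the 2018 correction): for `0 < β₁ < a ≤ b`, `h > 0`, granting Lemma 2.6 and
`φ_s(S) ≥ 1` for all `s > β₁`, `S ∋ 0`,
`1 - ⟨σ₀⟩²_{Λ_n,b,h} ≤ exp(-∫_a^b 2c_n(u)/u du) + ∫_a^b max(ε_n(u), 0) du`. [cite: DuminilCopinTassionCMP2016, §2.4, eqs. (2.8)–(2.9) (arXiv:1502.03050 numbering)] -/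
theorem one_sub_dctMag_sq_le (hdi : dct_meanField_differentialInequality (d := d)) (hd : 1 ≤ d)
    {β₁ a b h : ℝ} (hβ₁ : 0 < β₁) (ha : β₁ < a) (hab : a ≤ b) (hh : 0 < h)
    (hφ : ∀ s : ℝ, β₁ < s → ∀ S : Finset (Site d), (0 : Site d) ∈ S → 1 ≤ dctIsingPhi d s S)
    (n : ℕ) :
    1 - dctMag d (box d n) b h ^ 2 ≤
      Real.exp (-∫ u in a..b, 2 * dctRatioConst d (box d n) u h / u) +
        ∫ u in a..b, max (dctBoundaryError d (box d n) u h) 0 := by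
  have ha0 : 0 < a := hβ₁.trans ha
  set Λ := box d n with hΛ
  have h0 : (0 : Site d) ∈ Λ := zero_mem_box d n
  set g : ℝ → ℝ := fun s => 1 - dctMag d Λ s h ^ 2 with hg
  set k : ℝ → ℝ := fun s => 2 * dctRatioConst d Λ s h / s with hk
  set e : ℝ → ℝ := fun s => dctBoundaryError d Λ s h with he
  have hIcc : Icc a b ⊆ Ioi 0 := fun s hs => ha0.trans_le hs.1
  -- hypotheses of the Grönwall lemma
  have hgc : ContinuousOn g (Icc a b) :=
    (continuousOn_const.sub ((continuousOn_dctCorr Λ h {0}).pow 2)).mono hIcc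
  have hg' : ∀ s ∈ Ioo a b, HasDerivAt g (-deriv (fun s => dctMag d Λ s h ^ 2) s) s := by
    intro s hs
    have hs0 : s ≠ 0 := (ha0.trans hs.1).ne'
    simp only [hg]
    exact (differentiableAt_dctMag_sq Λ hs0 h).hasDerivAt.const_sub 1
  have hkc : ContinuousOn k (Icc a b) :=
    ((continuousOn_const.mul (continuousOn_dctRatioConst (box_nonempty d n) hh)).div
      continuousOn_id fun s hs => (ne_of_gt hs)).mono hIcc
  have hec : ContinuousOn e (Icc a b) := (continuousOn_dctBoundaryError Λ h).mono hIcc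
  have hk0 : ∀ s ∈ Icc a b, 0 ≤ k s := fun s hs =>
    div_nonneg (mul_nonneg zero_le_two (dctRatioConst_nonneg n (ha0.trans_le hs.1) hh))
      (ha0.trans_le hs.1).le
  have hineq : ∀ s ∈ Ioo a b, -deriv (fun s => dctMag d Λ s h ^ 2) s ≤ -k s * g s + e s := by
    intro s hs
    have hs0 : 0 < s := ha0.trans hs.1
    have hdi' := hdi hd hs0 hh h0
    -- `inf_S φ_s(S) ≥ 1`
    have hinf : 1 ≤ ⨅ S : {S : Finset (Site d) // (0 : Site d) ∈ S}, dctIsingPhi d s S.1 := by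
      haveI : Nonempty {S : Finset (Site d) // (0 : Site d) ∈ S} := ⟨⟨{0}, mem_singleton_self 0⟩⟩
      exact le_ciInf fun S => hφ s (ha.trans hs.1) S.1 S.2
    have hcoef : 0 ≤ 2 * dctRatioConst d Λ s h / s * (1 - dctMag d Λ s h ^ 2) := by
      refine mul_nonneg (div_nonneg (mul_nonneg zero_le_two (dctRatioConst_nonneg n hs0 hh)) hs0.le) ?_
      have := abs_le.1 (abs_dctCorr_le_one Λ s h {0})
      rw [dctMag]
      nlinarith
    have hmono : 2 * dctRatioConst d Λ s h / s * 1 * (1 - dctMag d Λ s h ^ 2) ≤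
        2 * dctRatioConst d Λ s h / s *
            (⨅ S : {S : Finset (Site d) // (0 : Site d) ∈ S}, dctIsingPhi d s S.1) *
          (1 - dctMag d Λ s h ^ 2) := by
      rw [mul_assoc, mul_assoc]
      refine mul_le_mul_of_nonneg_left ?_
        (div_nonneg (mul_nonneg zero_le_two (dctRatioConst_nonneg n hs0 hh)) hs0.le)
      refine mul_le_mul_of_nonneg_right hinf ?_
      have := abs_le.1 (abs_dctCorr_le_one Λ s h {0})
      rw [dctMag]
      nlinarith
    have := hmono.trans (by linarith [hdi'] : _ ≤ deriv (fun β' => dctMag d Λ β' h ^ 2) s + dctBoundaryError d Λ s h)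
    simp only [hk, hg, he, mul_one] at this ⊢
    linarith
  have hG := le_mul_exp_neg_integral_add_of_deriv_le hab hgc hg' hkc hec hk0 hineq
  have hga : g a ≤ 1 := by
    simp only [hg]
    nlinarith [sq_nonneg (dctMag d Λ a h)]
  have hexp : 0 ≤ Real.exp (-∫ u in a..b, k u) := (Real.exp_pos _).le
  calc 1 - dctMag d (box d n) b h ^ 2 = g b := rfl
    _ ≤ g a * Real.exp (-∫ u in a..b, k u) + ∫ u in a..b, max (e u) 0 := hG
    _ ≤ 1 * Real.exp (-∫ u in a..b, k u) + ∫ u in a..b, max (e u) 0 := by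
        gcongr
    _ = _ := by rw [one_mul]

/-- **Passing to the limit `Λ_n ↑ ℤ^d`** (Duminil-Copin–Tassion 2016, §2.4, from (2.9)–(2.10) to
the display before "Inequality (2.6) follows by letting `h` tend to `0`"): for `0 < β₁ < a ≤ b`
and `h > 0`, `1 - M(b,h)² ≤ (a/b)²`, by dominated convergence in both integrals of
`one_sub_dctMag_sq_le` (`c_n → 1` with `0 ≤ c_n ≤ 1`; `ε_n → 0` with `0 ≤ ε_n ≤ 8d/h`). [cite: DuminilCopinTassionCMP2016, §2.4, eqs. (2.9)–(2.10) and the following display (arXiv:1502.03050 numbering)] -/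
theorem one_sub_dctMagInf_sq_le (hdi : dct_meanField_differentialInequality (d := d))
    (hbd : dct_boundaryError_tendsto_zero (d := d)) (hghs : ghs_concaveOn_isingCorr_free_singleton)
    (hd : 1 ≤ d) {β₁ a b h : ℝ} (hβ₁ : 0 < β₁) (ha : β₁ < a) (hab : a ≤ b) (hh : 0 < h)
    (hφ : ∀ s : ℝ, β₁ < s → ∀ S : Finset (Site d), (0 : Site d) ∈ S → 1 ≤ dctIsingPhi d s S) :
    1 - dctMagInf d b h ^ 2 ≤ (a / b) ^ 2 := by
  have ha0 : 0 < a := hβ₁.trans ha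
  have hb0 : 0 < b := ha0.trans_le hab
  have hIoc : ∀ u ∈ Ioc a b, 0 < u := fun u hu => ha0.trans hu.1
  -- the three sequences
  have hLHS : Tendsto (fun n : ℕ => 1 - dctMag d (box d n) b h ^ 2) atTop
      (𝓝 (1 - dctMagInf d b h ^ 2)) :=
    ((tendsto_dctMag_box hb0 hh.le).pow 2).const_sub 1
  have hI : Tendsto (fun n : ℕ => ∫ u in a..b, 2 * dctRatioConst d (box d n) u h / u) atTop
      (𝓝 (∫ u in a..b, 2 / u)) := by
    refine intervalIntegral.tendsto_integral_filter_of_dominated_convergence (fun _ => 2 / a)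
      (Eventually.of_forall fun n => ?_) (Eventually.of_forall fun n => ae_of_all _ fun u hu => ?_)
      intervalIntegrable_const (ae_of_all _ fun u hu => ?_)
    · refine ContinuousOn.aestronglyMeasurable ?_ measurableSet_uIoc
      rw [uIoc_of_le hab]
      refine ((continuousOn_const.mul (continuousOn_dctRatioConst (box_nonempty d n) hh)).div
        continuousOn_id fun s hs => (ne_of_gt hs)).mono fun u hu => hIoc u hu
    · rw [uIoc_of_le hab] at hu
      have hu0 := hIoc u hu
      have hc0 := dctRatioConst_nonneg (d := d) n hu0 hh
      have hc1 := dctRatioConst_le_one (d := d) (zero_mem_box d n) u h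
      rw [Real.norm_eq_abs, abs_of_nonneg (div_nonneg (by positivity) hu0.le)]
      calc 2 * dctRatioConst d (box d n) u h / u ≤ 2 * 1 / u := by gcongr
        _ ≤ 2 / a := by rw [mul_one]; exact div_le_div_of_nonneg_left zero_le_two ha0 hu.1.le
    · rw [uIoc_of_le hab] at hu
      have hu0 := hIoc u hu
      have := ((tendsto_dctRatioConst_box (d := d) hu0 hh).const_mul 2).div_const u
      simpa using this
  have hIval : ∫ u in a..b, (2 : ℝ) / u = 2 * Real.log (b / a) := by
    have : (fun u : ℝ => (2 : ℝ) / u) = fun u => 2 * u⁻¹ := funext fun u => div_eq_mul_inv _ _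
    rw [this, intervalIntegral.integral_const_mul, integral_inv_of_pos ha0 hb0]
  have hJ : Tendsto (fun n : ℕ => ∫ u in a..b, max (dctBoundaryError d (box d n) u h) 0) atTop
      (𝓝 (∫ _u in a..b, (0 : ℝ))) := by
    refine intervalIntegral.tendsto_integral_filter_of_dominated_convergence (fun _ => 8 * d / h)
      (Eventually.of_forall fun n => ?_) (Eventually.of_forall fun n => ae_of_all _ fun u hu => ?_)
      intervalIntegrable_const (ae_of_all _ fun u hu => ?_)
    · refine ContinuousOn.aestronglyMeasurable ?_ measurableSet_uIoc
      rw [uIoc_of_le hab]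
      exact (ContinuousOn.mono (fun u hu' => ((continuousOn_dctBoundaryError (box d n) h) u hu').max
        continuousWithinAt_const) fun u hu => hIoc u hu)
    · rw [uIoc_of_le hab] at hu
      have hu0 := hIoc u hu
      rw [Real.norm_eq_abs, abs_of_nonneg (le_max_right _ _)]
      exact max_le (dctBoundaryError_le hghs (zero_mem_box d n) hu0 hh) (by positivity)
    · rw [uIoc_of_le hab] at hu
      have hu0 := hIoc u hu
      have := (hbd hd hu0 hh).max (tendsto_const_nhds (x := (0 : ℝ)))
      simpa using this
  rw [intervalIntegral.integral_zero] at hJ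
  -- combine
  have hRHS : Tendsto (fun n : ℕ =>
      Real.exp (-∫ u in a..b, 2 * dctRatioConst d (box d n) u h / u) +
        ∫ u in a..b, max (dctBoundaryError d (box d n) u h) 0) atTop
      (𝓝 (Real.exp (-(2 * Real.log (b / a))) + 0)) := by
    rw [← hIval]
    exact ((Real.continuous_exp.tendsto _).comp hI.neg).add hJ
  have hle := le_of_tendsto_of_tendsto' hLHS hRHS fun n =>
    one_sub_dctMag_sq_le hdi hd hβ₁ ha hab hh hφ n
  have hexp : Real.exp (-(2 * Real.log (b / a))) = (a / b) ^ 2 := by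
    have h2 : Real.exp (2 * Real.log (b / a)) = (b / a) ^ 2 := by
      rw [show (2 : ℝ) * Real.log (b / a) = Real.log (b / a) + Real.log (b / a) by ring,
        Real.exp_add, Real.exp_log (by positivity)]
      ring
    rw [Real.exp_neg, h2]
    field_simp
  rw [hexp, add_zero] at hle
  exact hle

/-- **Duminil-Copin–Tassion 2016, eq. (2.6), from the named facts** (the assembly of §2.4):
granting Lemma 2.6 (corrected), `ε(Λ_n) → 0`, the GHS concavity of the finite-volume
magnetisation and `lim_{h ↘ 0} ⟨σ₀⟩_{β,h} = m*(β)`, the mean-field lower bound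
`m*(β) ≥ √((β² - β₁²)/β²)` holds for every `β ≥ β₁ > 0` such that `φ_{β'}(S) ≥ 1` for all
`β' > β₁` and all finite `S ∋ 0` — i.e. the named fact `dct_magnetization_lower_bound`. [cite: DuminilCopinTassionCMP2016, §2.4, eq. (2.6) (arXiv:1502.03050 numbering)] -/
theorem dct_magnetization_lower_bound_of_facts (hdi : dct_meanField_differentialInequality (d := d))
    (hbd : dct_boundaryError_tendsto_zero (d := d)) (hghs : ghs_concaveOn_isingCorr_free_singleton)
    (hlim0 : freeCorr_singleton_tendsto_spontaneousMagnetization (d := d)) :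
    dct_magnetization_lower_bound (d := d) := by
  intro hd β₁ β hβ₁ hle hφ
  have hβ : 0 < β := hβ₁.trans_le hle
  -- lower bound on `M(β, h)` for every `h > 0`
  have hM : ∀ h : ℝ, 0 < h → Real.sqrt ((β ^ 2 - β₁ ^ 2) / β ^ 2) ≤ dctMagInf d β h := by
    intro h hh
    have hMpos : 0 < dctMagInf d β h := dctMagInf_pos hβ hh
    rcases eq_or_lt_of_le hle with heq | hlt
    · rw [heq, sub_self, zero_div, Real.sqrt_zero]
      exact hMpos.le
    · -- `1 - M² ≤ (a/β)²` for every `a ∈ (β₁, β)`, hence `≤ (β₁/β)²`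
      have hbound : ∀ a ∈ Ioo β₁ β, 1 - (a / β) ^ 2 ≤ dctMagInf d β h ^ 2 := by
        intro a ha
        have := one_sub_dctMagInf_sq_le hdi hbd hghs hd hβ₁ ha.1 ha.2.le hh hφ
        linarith
      have hlimit : 1 - (β₁ / β) ^ 2 ≤ dctMagInf d β h ^ 2 := by
        have hcont : Tendsto (fun a : ℝ => 1 - (a / β) ^ 2) (𝓝[>] β₁) (𝓝 (1 - (β₁ / β) ^ 2)) := by
          refine tendsto_nhdsWithin_of_tendsto_nhds ?_
          exact ((continuous_const.sub ((continuous_id.div_const β).pow 2)).tendsto β₁)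
        refine le_of_tendsto hcont ?_
        have hev : ∀ᶠ a in 𝓝[>] β₁, a ∈ Ioo β₁ β := Ioo_mem_nhdsGT hlt
        filter_upwards [hev] with a ha using hbound a ha
      have hsq : (β ^ 2 - β₁ ^ 2) / β ^ 2 = 1 - (β₁ / β) ^ 2 := by
        field_simp
      rw [hsq]
      calc Real.sqrt (1 - (β₁ / β) ^ 2) ≤ Real.sqrt (dctMagInf d β h ^ 2) := Real.sqrt_le_sqrt hlimit
        _ = dctMagInf d β h := Real.sqrt_sq hMpos.le
  -- `h ↘ 0`
  have hfree : ∀ k : ℝ, 0 < k → Real.sqrt ((β ^ 2 - β₁ ^ 2) / β ^ 2) ≤ freeCorr d β k {0} := by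
    intro k hk
    have := hM (β * k) (mul_pos hβ hk)
    rwa [dctMagInf, mul_div_cancel_left₀ _ hβ.ne'] at this
  refine ge_of_tendsto (hlim0 hd hβ.le) ?_
  filter_upwards [self_mem_nhdsWithin] with k hk using hfree k hk

end Assembly


/-! ### crit-ising.S08 from the four classical named facts -/

/-- **Exponential decay below `β_c` (crit-ising.S08) from the named facts of this file.**
Granting Duminil-Copin–Tassion's corrected Lemma 2.6 (`dct_meanField_differentialInequality`),
the vanishing of its correcting term (`dct_boundaryError_tendsto_zero`), the GHS concavity of
the finite-volume magnetisation (`ghs_concaveOn_isingCorr_free_singleton`) and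
`lim_{h ↘ 0} ⟨σ₀⟩_{β,h} = m*(β)` (`freeCorr_singleton_tendsto_spontaneousMagnetization`), the
free two-point function of the nearest-neighbour Ising model on `ℤ^d`, `d ≥ 2`, decays
exponentially for all `0 ≤ β < β_c` (`Literature.Probability.LatticeModels.twoPoint_exponentialDecay_of_lt_criticalBeta`):
everything else — the modified Simon inequality (`Literature.Probability.LatticeModels.isingTwoPoint_free_le_modifiedSimon`),
GKS I–II and the existence of the free state (`GKSInequalities`), translation covariance,
the iteration and the assembly (`SharpnessSubcritical`), and eq. (2.6) from the four facts
(`dct_magnetization_lower_bound_of_facts`) — is proved. [cite: DuminilCopinTassionCMP2016, Thm. 2.1 (third item), §2.4–2.5 (arXiv:1502.03050 numbering)] [cite: AizenmanBarskyFernandezJSP1987, Thm. 1] -/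
theorem twoPoint_exponentialDecay_of_meanField_facts
    (hdi : dct_meanField_differentialInequality (d := d))
    (hbd : dct_boundaryError_tendsto_zero (d := d)) (hghs : ghs_concaveOn_isingCorr_free_singleton)
    (hlim0 : freeCorr_singleton_tendsto_spontaneousMagnetization (d := d)) :
    twoPoint_exponentialDecay_of_lt_criticalBeta (d := d) :=
  twoPoint_exponentialDecay_of_facts'
    (fun hβ _ _ hSΛ h0 _ hz hzS =>
      isingTwoPoint_free_le_modifiedSimon (zdGraph d) hβ.le hSΛ h0 hz hzS)
    (dct_magnetization_lower_bound_of_facts hdi hbd hghs hlim0)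
    (Literature.Probability.LatticeModels.GKSInequalities.gks_one_holds (zdGraph d))
    (fun G' _ _ _ _ _ _ _ => Literature.Probability.LatticeModels.GKSInequalities.gks_two_holds G')
    Literature.Probability.LatticeModels.hasBoxLimit_isingCorr_free_holds

/-! ### Appendix: `lim_{h ↘ 0} ⟨σ₀⟩^∅_{β,h} = m*(β)` from uniqueness at `h ≠ 0` (split of the
fourth fact, following the review of p9326: the right-continuity in `h` is proved here) -/

/-- **Friedli–Velenik 2017, Thm. 3.25 (1)** ("In any `d ≥ 1`, when `h ≠ 0`, there is a unique
Gibbs state for all values of `β ∈ ℝ_{≥0}`"), in the consequence used by Duminil-Copin–Tassion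
(their `⟨·⟩_{β,h}` is the free state) and by Remark 3.30: at `h > 0` the free and the plus
one-point functions coincide, `⟨σ₀⟩^∅_{β,h} = ⟨σ₀⟩⁺_{β,h}` (both are Gibbs states: Thm. 3.17 and
Exercise 3.16). Nearest-neighbour model on `ℤ^d`, `d ≥ 1`, `β ≥ 0`, tree parametrisation of the
field (`h > 0` iff `βh > 0` for `β > 0`; at `β = 0` both sides are the uniform single-site
average). [cite: FriedliVelenik2017, Thm. 3.25 (1), p. 116 (uniqueness for h ≠ 0), with Thm. 3.17 and Exercise 3.16] -/
def freeCorr_eq_plusCorr_singleton_of_pos : Prop :=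
  ∀ (_ : 1 ≤ d) {β h : ℝ}, 0 ≤ β → 0 < h → freeCorr d β h {0} = plusCorr d β h {0}

/-- **Right-continuity of `h ↦ ⟨σ_A⟩⁺_{β,h}`** at every `h₀ ≥ 0`, for `β ≥ 0` (Friedli–Velenik
2017, Lemma 3.31 (1), p. 119: "`h ↦ ⟨σ₀⟩⁺_{β,h}` is nondecreasing and right-continuous"; proved
as there and as the tree's `plusCorr_continuousWithinAt_Ici` (the `β`-version): the plus state
is the infimum over boxes of finite-volume plus correlations, which are continuous and
nondecreasing in `h`). [cite: FriedliVelenik2017, Lemma 3.31 (1), p. 119] -/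
theorem plusCorr_continuousWithinAt_Ici_field {β : ℝ} (hβ : 0 ≤ β) (A : Finset (Site d)) {h₀ : ℝ}
    (hh₀ : 0 ≤ h₀) : ContinuousWithinAt (fun h => plusCorr d β h A) (Set.Ici h₀) h₀ := by
  obtain ⟨L₀, hL₀⟩ := exists_forall_subset_box d A
  rw [Metric.continuousWithinAt_iff]
  intro ε hε
  have hconv := Literature.Probability.LatticeModels.hasBoxLimit_isingCorr_plus_holds (d := d) hβ hh₀ A
  have hev : ∀ᶠ L : ℕ in atTop, L₀ ≤ L ∧
      isingCorr (zdGraph d) (box d L) β h₀ .plus A < plusCorr d β h₀ A + ε / 2 :=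
    (eventually_ge_atTop L₀).and (hconv.eventually (gt_mem_nhds (by linarith)))
  obtain ⟨L, hLL₀, hL⟩ := hev.exists
  have hc : Continuous fun h : ℝ => isingCorr (zdGraph d) (box d L) β h .plus A :=
    continuous_isingExpect_field (zdGraph d) (box d L) β .plus (measurable_spinProduct A)
  have hcont := hc.continuousAt (x := h₀)
  rw [Metric.continuousAt_iff] at hcont
  obtain ⟨δ, hδ, hδ'⟩ := hcont (ε / 2) (by linarith)
  refine ⟨δ, hδ, fun h hh hdist => ?_⟩
  have h0h : h₀ ≤ h := hh
  have h1 : plusCorr d β h₀ A ≤ plusCorr d β h A := plusCorr_mono_params hβ le_rfl hh₀ h0h A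
  have h2 : plusCorr d β h A ≤ isingCorr (zdGraph d) (box d L) β h .plus A :=
    plusCorr_le_isingCorr_plus_box hβ (hh₀.trans h0h) (hL₀ L hLL₀)
  have h3 : dist (isingCorr (zdGraph d) (box d L) β h .plus A)
      (isingCorr (zdGraph d) (box d L) β h₀ .plus A) < ε / 2 := hδ' hdist
  rw [Real.dist_eq, abs_lt] at h3
  rw [Real.dist_eq, abs_lt]
  constructor <;> linarith

/-- **`lim_{h ↘ 0} ⟨σ₀⟩^∅_{β,h} = m*(β)` from uniqueness at `h ≠ 0`** (Friedli–Velenik 2017,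
Remark 3.30: "considering a sequence `h ↓ 0` … `m*(β) = lim_{h↓0} m(β,h) = lim_{h↓0} m⁺(β,h) =
m⁺(β,0) = ⟨σ₀⟩⁺_{β,0}`"): granting `freeCorr_eq_plusCorr_singleton_of_pos` (Thm. 3.25 (1)), the
fourth named fact `freeCorr_singleton_tendsto_spontaneousMagnetization` follows from the proved
right-continuity of `h ↦ ⟨σ₀⟩⁺_{β,h}` at `h = 0`. [cite: FriedliVelenik2017, Remark 3.30, p. 118] -/
theorem freeCorr_singleton_tendsto_spontaneousMagnetization_of_uniqueness
    (huniq : freeCorr_eq_plusCorr_singleton_of_pos (d := d)) :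
    freeCorr_singleton_tendsto_spontaneousMagnetization (d := d) := by
  intro hd β hβ
  have hrc := plusCorr_continuousWithinAt_Ici_field (d := d) hβ {0} le_rfl
  have h1 : Tendsto (fun h : ℝ => plusCorr d β h {0}) (𝓝[>] 0)
      (𝓝 (spontaneousMagnetization d β)) := by
    rw [spontaneousMagnetization_eq_plusCorr]
    exact hrc.tendsto.mono_left (nhdsWithin_mono _ Set.Ioi_subset_Ici_self)
  refine h1.congr' ?_
  filter_upwards [self_mem_nhdsWithin] with h hh
  exact (huniq hd hβ hh).symm

/-- **Eq. (2.6) from Lemma 2.6, `ε → 0`, GHS concavity and uniqueness at `h ≠ 0`.** [cite: DuminilCopinTassionCMP2016, §2.4, eq. (2.6) (arXiv:1502.03050 numbering)] -/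
theorem dct_magnetization_lower_bound_of_facts' (hdi : dct_meanField_differentialInequality (d := d))
    (hbd : dct_boundaryError_tendsto_zero (d := d)) (hghs : ghs_concaveOn_isingCorr_free_singleton)
    (huniq : freeCorr_eq_plusCorr_singleton_of_pos (d := d)) :
    dct_magnetization_lower_bound (d := d) :=
  dct_magnetization_lower_bound_of_facts hdi hbd hghs
    (freeCorr_singleton_tendsto_spontaneousMagnetization_of_uniqueness huniq)

/-- **crit-ising.S08 from Lemma 2.6, `ε → 0`, GHS concavity and uniqueness at `h ≠ 0`.** [cite: DuminilCopinTassionCMP2016, Thm. 2.1 (third item), §2.4–2.5 (arXiv:1502.03050 numbering)] -/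
theorem twoPoint_exponentialDecay_of_meanField_facts'
    (hdi : dct_meanField_differentialInequality (d := d))
    (hbd : dct_boundaryError_tendsto_zero (d := d)) (hghs : ghs_concaveOn_isingCorr_free_singleton)
    (huniq : freeCorr_eq_plusCorr_singleton_of_pos (d := d)) :
    twoPoint_exponentialDecay_of_lt_criticalBeta (d := d) :=
  twoPoint_exponentialDecay_of_meanField_facts hdi hbd hghs
    (freeCorr_singleton_tendsto_spontaneousMagnetization_of_uniqueness huniq)

end Literature.Probability.LatticeModels
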